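import Literature.MathematicalPhysics.QuantumFieldTheory.Balaban1983to89.Beta.AveragingGaugeModes

/-!
# `Balaban1983to89.Beta.AveragingAxialDictionary` — the AVERAGING HALF of the tree-slice dictionary at `U = 1`:
# Bałaban's contour average IS the straight average of the AXIAL REPRESENTATIVE, `Q_Bal = Q_typed ∘ Π_ax`; the tree
# potential vanishes at the base points; `Π_ax` is idempotent, kills the residual-algebra gauge modes and is blind to
# them; and `Q_Bal ∘ D = 0` on the residual algebra at orders `B⁰` (node 5) and `B¹` (node 10) — letter algebra, v1

HONEST FRAMING (page 1, mandatory).  This leaf belongs to the β sub-cell of the Bałaban audit, whose END STATEMENT is: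
discharging the one-loop hypothesis `FlowStep.BetaPertH` (read at END-STATEMENT grade, RULING (R6)) makes Bałaban's
ultraviolet stability theorem for 4-d lattice Yang–Mills ([Balaban1989LargeFieldII], Thm. 1 p. 355 (B16))
UNCONDITIONAL inside this package — a real constructive-QFT result; it is NOT the continuum limit and NOT the Clay
problem.  Gloss 2: EVERYTHING below is kernel-proved [folklore] algebra of finite sums over an additive commutative
group / a ring about node 5's and node 10's DEFINITIONS; NOTHING is cited as a fact.  [Balaban1984PropagatorsI]
(= B5) and [Balaban1985Averaging] (= B7) are named only to say WHICH objects are being typed; the manuscripts under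
audit are not citable for their disputed steps and no programme-internal claim enters.

ABSOLUTE RULE (cell charter, verbatim): «No internally-minted statement may enter as a cited fact. Every hypothesis is
either kernel-proved in this package or a verbatim quotation of a PUBLISHED theorem with page reference. The
manuscript(s) under audit are NOT citable for their own disputed steps — they are the thing under adjudication;
programme-internal (2001/route/tribunal) claims are never citable.»  Accordingly NO declaration below is a
`def … : Prop` carrying a citation and no hypothesis of any theorem is a printed statement: every declaration is
[folklore]; printed displays are object LOCATORS only, and all of them are the ones ALREADY quoted verbatim in node 5's
header (`Beta.AveragingContours` §5: B5 p.19 (1.8), (1.9), (1.10) «Axial (Ax) gauge fixing conditions A(Γ_{y,x}) = 0,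
x ∈ B(y), x ≠ y», (1.11), (1.13), and «we restrict the gauge transformations by the condition λ(y) = 0, y ∈ T^{(1)}_L»)
— no print span is entered or repeated here.

THE DICTIONARY (informal; all objects are node 5's, at `U = 1`, first order, unnormalised as landed).  On the fine
lattice `ℤ^d` with `L`-blocks `B(y)` based at `L•y`:
  `Q_Bal`  := node 5 `linAvg`      — Bałaban's contour average (1.8)/(14): `Σ_{x ∈ B(c₋)} A(Γ_{c₋,x} ∪ [x, x(c)] ∪ Γ⁻¹)`;
  `Q_typed`:= node 5 `straightSum` — the straight average (1.11) «given by Q directly» (= an2's `contourSum`,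
             node 5 `straightSum_eq_contourSum`);
  `t_A`    := node 5 `treeGauge A L`, `t_A(x) = A(Γ_{L•blk x, x})` — the integral of `A` along the block axial tree
             (the «G_tree ∘ τ_tree» of the tree slice);
  `Π_ax A` := `A − grad t_A`       — the AXIAL REPRESENTATIVE (node 5 `axialGauge_treeGauge`: it satisfies (1.10));
  `𝔫_ev`   := `{λ : λ(L•y) = 0 ∀ y}` — the residual gauge algebra of (1.10) («λ(y) = 0, y ∈ T^{(1)}_L»), here always
             the HYPOTHESIS `∀ y, λ ((L : ℤ) • y) = 0` of a theorem, never a structure.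
In these letters the β-lead's RULING (R29) (journal 2026-08-19, a cell event — TRIGGER of this leaf, not a source) asks,
for the type-preserving tree-slice route (α), the dictionary clause «Q_Bal = Q_typed ∘ Π_ax, Q_Bal ∘ D_B λ = 0 for
λ ∈ 𝔫_ev» at `U = 1`; an2 owns `Π` as a kernel and the statement in its `JsBal` leaf, an1 (this leaf) the averaging
half.  Nothing about slices, Faddeev–Popov factors or determinants is typed or claimed here.

WHAT IS PROVED (all [folklore], sorry-free; node 5 / node 8 / node 10 are used BY NAME, never restated):
§1 THE TREE POTENTIAL AT BASE POINTS: `smul_blk_base : L • blk L (L•y) = L•y` (every `L`, incl. the degenerate `L = 0`),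
   **`treeGauge_base : treeGauge A L (L•y) = 0`**, `treeGauge_base_add` (at `c₊ = L•y + L•e_μ`) — `t_A ∈ 𝔫_ev`;
   `treeGauge_sub` (additivity), `treeGauge_grad : treeGauge (grad λ) L x = λ x − λ(L • blk x)`.
§2 THE PROJECTOR: **`treeGauge_axialProj : treeGauge (A − grad t_A) L = 0`** (so `Π_ax ∘ Π_ax = Π_ax`:
   `axialProj_idem`); `axialProj_grad : Π_ax (grad λ) = grad (x ↦ λ(L • blk x))` (the projector maps a gauge mode to the
   gauge mode of the BLOCK-CONSTANT extension of `λ|base points`), hence **`axialProj_grad_of_base : Π_ax (grad λ) = 0`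
   for `λ ∈ 𝔫_ev`**; **`axialProj_gauge : Π_ax (A − grad λ) = Π_ax A` for `λ ∈ 𝔫_ev`** (blindness to the residual
   algebra); `τ_tree ∘ Π_ax = 0` is node 5 `axialGauge_treeGauge` by name.
§3 THE AVERAGING CLAUSE: **`linAvg_eq_straightSum_axialProj : linAvg A L μ y = straightSum (A − grad (treeGauge A L)) L μ y`
   for EVERY `A`** (`Q_Bal = Q_typed ∘ Π_ax`; = node 5 `linAvg_gauge` + `treeGauge_base` + `linAvg_eq_straightSum_of_
   axialGauge (axialGauge_treeGauge A L)`), its `CommRing` form `linAvg_eq_contourSum_axialProj` in an2's `contourSum`/`dz`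
   vocabulary, and `straightSum_axialProj_gauge` (`Q_typed ∘ Π_ax` is `𝔫_ev`-invariant).
§4 `Q_Bal ∘ D = 0` ON `𝔫_ev`: (B⁰) **`linAvg_grad_of_base : linAvg (grad λ) L μ y = 0`**; (B¹, product chart, fluctuation
   LEFT per (R25-2)) **`vhU_grad_add_linAvg_gmode1_of_base : vhU (grad λ) B L μ y + (2L^d) • linAvg (gmode1 B λ) L μ y = 0`**
   («V(W₀λ, B) + Z(W₁(B)λ) = 0» — node 10 (B¹) with `λ̄ = 0`), and the exponential-chart companion
   `hessU_grad_left_of_base : hessU (grad λ) B L μ y = linAvg (midC λ B) L μ y` (node 8 (W-H1) with `λ̄ = 0`).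

NOT PROVED, NOT CLAIMED: the `B²` (and higher) letters of `Q_Bal(B) ∘ D_B = 0` on `𝔫_ev` (EXACT at group level — every
contour holonomy `c₋ → c₊` is invariant under `u` with `u(c∓) = 1` — but at letter level it needs the third averaging
jet `T₂`, not typed; scoped in the an1 lineage notes); anything at `U ≠ 1`; an2's kernel `Π_N`, its finite range,
`K ∘ Π = K`, the per-block unipotency `|det(τ_tree · D_B ↾ 𝔫_ev)| = 1` (an2 (A1); model level: `Beta.TreeSliceUnipotent`);
compositions of block trees; anything about slices / FP / determinants; `BetaPertH`.

RELATION TO `Beta.AxialProjector` (an2, landed CONCURRENTLY as p190956; recorded in v1.0.2 — ONE NAME PER FACT).  an2's leaf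
DEFINES the same projector, `AxialProjector.axProj L A := A - grad (treeGauge A L)` (so every statement below applies to `axProj L A`
by `rfl`), and is the PRIMARY HOME of all Π-facts: `axProj`/`axProj_apply`/`axProj_eq_sub_dz`, `axialGauge_axProj`, `axProj_idem`,
`axProj_eq_self_of_axialGauge`, `axialGauge_iff_axProj_eq`, `axProj_eq_zero_iff`, `axProj_grad`, `axProj_grad_eq_zero`,
`axProj_grad_of_blockConst`, additivity / `axProj_smul` / `axProj_map`, locality `axProj_congr_local`, covariance `axProj_shift`,
the `U = 1` dictionary `linAvg_axProj` / `linAvg_axProj_eq_straightSum` / `linAvg_eq_contourSum_axProj`, and its own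
`treeGauge_base` / `treeGauge_grad` / `treeGauge_sub` (same names as §1 here with different binders — `open` ONE of the two
namespaces, or qualify).  CITE THIS LEAF ONLY FOR what `AxialProjector` v1 does not carry: (s1) the `1 ≤ L`-free forms
(`smul_blk_base` for every `L`, hence §1–§3 without `hL`; immaterial in the programme, where `L ≥ 2` — prefer an2's names);
(s2) the one-step `𝔫_ev`-blindness `axialProj_gauge` / `straightSum_axialProj_gauge` (derivable from `axProj_sub` +
`axProj_grad_eq_zero`); (s3) THE AVERAGING HALF PROPER, §4 — `linAvg_grad_of_base`, `vhU_grad_add_linAvg_gmode1_of_base`,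
`hessU_grad_left_of_base` — which nothing else in the tree states.  No Π-lemma will be added to the an1 lineage after v1; Π is
an2's object (cell ruling (R29-5)).

Provenance: pub-balaban β sub-cell, ANALYSIS PROVER AN1 lineage (gen 12, node 11 AVERAGING-AXIAL-DICTIONARY).  Imports
node 10 `Beta.AveragingGaugeModes` (⇒ nodes 8, 7b, 7a, 5, 3).  Versions: v1 = p190987 (5f900c411dd8); v1.0.1 = p191042
(docstring: B16 Thm 1 page locator p. 355); v1.0.2 = this docstring paragraph (relation to `Beta.AxialProjector`); declarations
byte-identical since v1.  NOT summit progress.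
-/

namespace Literature.MathematicalPhysics.QuantumFieldTheory.Balaban1983to89.Beta.AveragingAxialDictionary

open Literature.MathematicalPhysics.QuantumFieldTheory.Balaban1983to89.Beta.AffineAveraging
open Literature.MathematicalPhysics.QuantumFieldTheory.Balaban1983to89.Beta.AveragingContours
open Literature.MathematicalPhysics.QuantumFieldTheory.Balaban1983to89.Beta.AveragingHessianKernels
open Literature.MathematicalPhysics.QuantumFieldTheory.Balaban1983to89.Beta.AveragingWardJets (midC hessU_grad_left)
open Literature.MathematicalPhysics.QuantumFieldTheory.Balaban1983to89.Beta.AveragingGaugeModes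
  (gmode1 cgmode1_apply vhU_grad_add_linAvg_gmode1)

/-! ## §1 The tree potential at the base points -/

section Tree

variable {d : ℕ} {R : Type*} [AddCommGroup R]

/-- [folklore] The block index of a base point, rescaled: `L • blk L (L•y) = L•y` for EVERY `L` (for `L = 0` both sides
are `0`). -/
theorem smul_blk_base (L : ℕ) (y : Fin d → ℤ) : (L : ℤ) • blk L ((L : ℤ) • y) = (L : ℤ) • y := by
  rcases Nat.eq_zero_or_pos L with h | h
  · subst h; simp
  · have hb0 : (fun _ : Fin d => (0 : ℕ)) ∈ box d L := by
      simp only [AffineAveraging.box, Fintype.mem_piFinset, Finset.mem_range]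
      intro i; omega
    have hb := blk_block (L := L) y hb0
    rw [toSite_zero, add_zero] at hb
    rw [hb]

/-- [folklore] **THE TREE POTENTIAL VANISHES AT THE BASE POINTS**: `t_A(L•y) = A(Γ_{L•y, L•y}) = 0` — `t_A ∈ 𝔫_ev`. -/
theorem treeGauge_base (A : Form1 d R) (L : ℕ) (y : Fin d → ℤ) : treeGauge A L ((L : ℤ) • y) = 0 := by
  rw [treeGauge, smul_blk_base, axial_self, List.sum_nil]

/-- [folklore] … in particular at the far endpoint `c₊ = L•y + L•e_μ` of a coarse bond. -/
theorem treeGauge_base_add (A : Form1 d R) (L : ℕ) (μ : Fin d) (y : Fin d → ℤ) :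
    treeGauge A L ((L : ℤ) • y + (L : ℤ) • unitVec μ) = 0 := by
  rw [← smul_add]; exact treeGauge_base A L (y + unitVec μ)

/-- [folklore] The tree potential is additive (difference form). -/
theorem treeGauge_sub (A A' : Form1 d R) (L : ℕ) (x : Fin d → ℤ) :
    treeGauge (A - A') L x = treeGauge A L x - treeGauge A' L x := by
  simp only [treeGauge, axial_sum_sub]

/-- [folklore] The tree potential of a gauge mode: `t_{dλ}(x) = λ(x) − λ(L • blk x)` (`λ` minus its value at the base
point of the block of `x`). -/
theorem treeGauge_grad (lam : (Fin d → ℤ) → R) (L : ℕ) (x : Fin d → ℤ) :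
    treeGauge (grad lam) L x = lam x - lam ((L : ℤ) • blk L x) := by
  rw [treeGauge, axial_sum_grad]

end Tree

/-! ## §2 The axial representative `Π_ax A = A − grad t_A` -/

section Projector

variable {d : ℕ} {R : Type*} [AddCommGroup R]

/-- [folklore] **THE AXIAL REPRESENTATIVE HAS NO TREE POTENTIAL**: `t_{Π_ax A} = 0`. -/
theorem treeGauge_axialProj (A : Form1 d R) (L : ℕ) (x : Fin d → ℤ) :
    treeGauge (A - grad (treeGauge A L)) L x = 0 := by
  rw [treeGauge_sub, treeGauge_grad, treeGauge, treeGauge, smul_blk_base, axial_self, List.sum_nil, sub_zero, sub_self]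

/-- [folklore] Hence `Π_ax` is idempotent: `Π_ax (Π_ax A) = Π_ax A`. -/
theorem axialProj_idem (A : Form1 d R) (L : ℕ) :
    (A - grad (treeGauge A L)) - grad (treeGauge (A - grad (treeGauge A L)) L) = A - grad (treeGauge A L) := by
  have h : treeGauge (A - grad (treeGauge A L)) L = fun _ => 0 := funext fun x => treeGauge_axialProj A L x
  rw [h]
  funext κ x
  simp [grad]

/-- [folklore] **`Π_ax` OF A GAUGE MODE** is the gauge mode of the BLOCK-CONSTANT extension of `λ|base points`:
`Π_ax (grad λ) = grad (x ↦ λ(L • blk x))`. -/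
theorem axialProj_grad (lam : (Fin d → ℤ) → R) (L : ℕ) :
    grad lam - grad (treeGauge (grad lam) L) = grad fun x => lam ((L : ℤ) • blk L x) := by
  funext κ x
  simp only [Pi.sub_apply, grad, treeGauge_grad]
  abel

/-- [folklore] **`Π_ax` KILLS THE RESIDUAL-ALGEBRA GAUGE MODES**: `λ ∈ 𝔫_ev ⇒ Π_ax (grad λ) = 0`. -/
theorem axialProj_grad_of_base {lam : (Fin d → ℤ) → R} {L : ℕ} (hlam : ∀ y : Fin d → ℤ, lam ((L : ℤ) • y) = 0) :
    grad lam - grad (treeGauge (grad lam) L) = 0 := by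
  rw [axialProj_grad]
  funext κ x
  simp only [grad, hlam, sub_self, Pi.zero_apply]

/-- [folklore] **`Π_ax` IS BLIND TO THE RESIDUAL ALGEBRA**: `λ ∈ 𝔫_ev ⇒ Π_ax (A − grad λ) = Π_ax A`. -/
theorem axialProj_gauge (A : Form1 d R) {lam : (Fin d → ℤ) → R} {L : ℕ}
    (hlam : ∀ y : Fin d → ℤ, lam ((L : ℤ) • y) = 0) :
    (A - grad lam) - grad (treeGauge (A - grad lam) L) = A - grad (treeGauge A L) := by
  funext κ x
  simp only [Pi.sub_apply, grad, treeGauge_sub, treeGauge_grad, hlam, sub_zero]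
  abel

end Projector

/-! ## §3 The averaging clause `Q_Bal = Q_typed ∘ Π_ax` -/

section Averaging

variable {d : ℕ} {R : Type*} [AddCommGroup R]

/-- [folklore] **BAŁABAN'S CONTOUR AVERAGE IS THE STRAIGHT AVERAGE OF THE AXIAL REPRESENTATIVE**, for EVERY field:
`linAvg A L μ y = straightSum (A − grad (treeGauge A L)) L μ y` (`Q_Bal = Q_typed ∘ Π_ax` at `U = 1`). -/
theorem linAvg_eq_straightSum_axialProj (A : Form1 d R) (L : ℕ) (μ : Fin d) (y : Fin d → ℤ) :
    linAvg A L μ y = straightSum (A - grad (treeGauge A L)) L μ y := by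
  rw [← linAvg_eq_straightSum_of_axialGauge (axialGauge_treeGauge A L), linAvg_gauge, treeGauge_base_add,
    treeGauge_base, sub_self, smul_zero, sub_zero]

/-- [folklore] **`Q_typed ∘ Π_ax` IS INVARIANT UNDER THE RESIDUAL ALGEBRA**: `λ ∈ 𝔫_ev ⇒ straightSum (Π_ax (A − grad λ))
= straightSum (Π_ax A)`. -/
theorem straightSum_axialProj_gauge (A : Form1 d R) {lam : (Fin d → ℤ) → R} {L : ℕ}
    (hlam : ∀ y : Fin d → ℤ, lam ((L : ℤ) • y) = 0) (μ : Fin d) (y : Fin d → ℤ) :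
    straightSum ((A - grad lam) - grad (treeGauge (A - grad lam) L)) L μ y
      = straightSum (A - grad (treeGauge A L)) L μ y := by
  rw [axialProj_gauge A hlam]

end Averaging

section AveragingComm

variable {d : ℕ} {R : Type*} [CommRing R]

/-- [folklore] The averaging clause in an2's vocabulary: `linAvg A L μ y = contourSum L (A − dz (treeGauge A L)) μ y`. -/
theorem linAvg_eq_contourSum_axialProj (A : Form1 d R) (L : ℕ) (μ : Fin d) (y : Fin d → ℤ) :
    linAvg A L μ y = contourSum L (A - dz (treeGauge A L)) μ y := by
  rw [linAvg_eq_straightSum_axialProj, straightSum_eq_contourSum, grad_eq_dz]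

end AveragingComm

/-! ## §4 `Q_Bal ∘ D = 0` on the residual algebra, orders `B⁰` and `B¹` -/

section GaugeModes

variable {d : ℕ}

/-- [folklore] (B⁰) **A RESIDUAL-ALGEBRA GAUGE MODE AVERAGES TO ZERO**: `λ ∈ 𝔫_ev ⇒ linAvg (grad λ) L μ y = 0`
(node 5 `linAvg_grad` with the restricted gauge function `λ̄ = 0`). -/
theorem linAvg_grad_of_base {R : Type*} [AddCommGroup R] {lam : (Fin d → ℤ) → R} {L : ℕ}
    (hlam : ∀ y : Fin d → ℤ, lam ((L : ℤ) • y) = 0) (μ : Fin d) (y : Fin d → ℤ) : linAvg (grad lam) L μ y = 0 := by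
  rw [linAvg_grad, ← smul_add, hlam, hlam, sub_self, smul_zero]

variable {𝔸 : Type*} [Ring 𝔸]

/-- [folklore] (B¹) **THE `B`-LINEAR LETTER OF `Q_Bal(B)·W(B)λ` VANISHES ON `𝔫_ev`** (product chart, fluctuation LEFT):
`λ ∈ 𝔫_ev ⇒ vhU (grad λ) B L μ y + (2L^d) • linAvg (gmode1 B λ) L μ y = 0`, i.e. «V(W₀λ, B) + Z(W₁(B)λ) = 0» —
node 10 `vhU_grad_add_linAvg_gmode1` with `λ(c₊) = 0`. -/
theorem vhU_grad_add_linAvg_gmode1_of_base {lam : (Fin d → ℤ) → 𝔸} {L : ℕ}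
    (hlam : ∀ y : Fin d → ℤ, lam ((L : ℤ) • y) = 0) (B : Form1 d 𝔸) (μ : Fin d) (y : Fin d → ℤ) :
    vhU (grad lam) B L μ y + (2 * (L : ℤ) ^ d) • linAvg (gmode1 B lam) L μ y = 0 := by
  rw [vhU_grad_add_linAvg_gmode1, cgmode1_apply, ← smul_add, hlam, comm_zero_right, smul_zero]

/-- [folklore] The exponential-chart companion (node 8 (W-H1) with `λ̄ = 0`): `λ ∈ 𝔫_ev ⇒ hessU (grad λ) B L μ y =
linAvg (midC λ B) L μ y` — the symmetrised Hessian of a residual gauge mode against `B` is the plain average of the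
one-form `b ↦ [λ(b₋) + λ(b₊), B_b]`, with no coarse commutator left over. -/
theorem hessU_grad_left_of_base {lam : (Fin d → ℤ) → 𝔸} {L : ℕ}
    (hlam : ∀ y : Fin d → ℤ, lam ((L : ℤ) • y) = 0) (B : Form1 d 𝔸) (μ : Fin d) (y : Fin d → ℤ) :
    hessU (grad lam) B L μ y = linAvg (midC lam B) L μ y := by
  rw [hessU_grad_left, ← smul_add, hlam, hlam, add_zero, comm_zero_left, sub_zero]

end GaugeModes

end Literature.MathematicalPhysics.QuantumFieldTheory.Balaban1983to89.Beta.AveragingAxialDictionary
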